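import Summits.KontsevichZagierPeriods.KontsevichZagierPeriods.Theorems.HermiteRigidityIslandComplementBoxDuplication

/-!
# `ReductionRigidity` (stmt-KontsevichZagierPeriods-3407), line `Sketch`, cycle 3 (the duplication join
# island, levels `N`, `−N`, `N²`): the weight-one duplication (`stub_dupJoinWeightOne`)

Route `KontsevichZagierPeriods/HermiteRigidity`, crux `ReductionRigidity` (stmt-3407); registered
sub-goal stub D1 of the DUPLICATION JOIN ISLAND. For every integer `N ≥ 2` and every rational `β`,

  `[□¹, β/(N² − p)] − [□¹, β/(N − u)] − [□¹, β/((−N) − u)] ∈ KZ.relations`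

(values `β log(N²/(N² − 1)) = β log(N/(N − 1)) + β log(N/(N + 1))`): the weight-one duplication
formula of the logarithm as a chain of TWO moves on the closed interval `□¹ = [0,1]`. The squaring
chart `p = u²` (rule 2 along the self-map `BoxIntegral.coordPow 2` of the cube, `|dp/du| = 2u`; the
move `rel_coordPow_two` of the weight-two box duplication applies verbatim in dimension one) turns
`[□¹, β/(N² − p)]` into `[□¹, 2βu/(N² − u²)]`, and ONE integrand additivity (rule 1b) realises the
partial fraction `2βu/(N² − u²) = β/(N − u) + β/((−N) − u)`; the quantified representations are
bridged to the regular-rational cube representations by congruence.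

References: M. Kontsevich, D. Zagier, *Periods* (2001), §1.2 rules (1), (2)
[cite: KontsevichZagier2001, §1.2]. No definitions are introduced.
-/

noncomputable section

open MeasureTheory Set MvPolynomial

namespace Summit.KontsevichZagierPeriods.HermiteRigidity.ReductionRigidity

open Literature.NumberTheory.Transcendental
open Literature.NumberTheory.Transcendental.KZ

/-- The four weight-one integrands `β/(N² − u)`, `2βu/(N² − u²)`, `β/(N − u)`, `β/((−N) − u)`
(`N ≥ 2`) are regular rational functions on `□¹`: regular rational functions `R, W, S, T` with these
values on the closed interval exist (denominators `≥ 3`, `≥ 3`, `≥ 1`, `≤ −2` on `[0,1]`).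
[cite: KontsevichZagier2001, §1.1] -/
theorem exists_rfun_dupJoinWeightOne {N : ℕ} (hN : 2 ≤ N) (β : ℚ) :
    ∃ R W S T : RFun 1,
      (∀ x ∈ cube 1, R.fn x = (β : ℝ) / ((N : ℝ) ^ 2 - x 0)) ∧
      (∀ x ∈ cube 1, W.fn x = 2 * (β : ℝ) * x 0 / ((N : ℝ) ^ 2 - x 0 ^ 2)) ∧
      (∀ x ∈ cube 1, S.fn x = (β : ℝ) / ((N : ℝ) - x 0)) ∧
      (∀ x ∈ cube 1, T.fn x = (β : ℝ) / ((-(N : ℝ)) - x 0)) := by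
  have h2 : (2:ℝ) ≤ (N:ℝ) := by exact_mod_cast hN
  have hR : ∀ x ∈ cube 1, aeval x (C ((N:ℚ) ^ 2) - X 0 : MvPolynomial (Fin 1) ℚ) ≠ 0 := by
    intro x hx
    have h0 := (hx 0).1
    have h1 := (hx 0).2
    simp only [map_sub, map_pow, aeval_C, aeval_X, eq_ratCast, Rat.cast_natCast]
    nlinarith
  have hW : ∀ x ∈ cube 1, aeval x (C ((N:ℚ) ^ 2) - X 0 ^ 2 : MvPolynomial (Fin 1) ℚ) ≠ 0 := by
    intro x hx
    have h0 := (hx 0).1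
    have h1 := (hx 0).2
    simp only [map_sub, map_pow, aeval_C, aeval_X, eq_ratCast, Rat.cast_natCast]
    nlinarith
  have hS : ∀ x ∈ cube 1, aeval x (C (N:ℚ) - X 0 : MvPolynomial (Fin 1) ℚ) ≠ 0 := by
    intro x hx
    have h1 := (hx 0).2
    simp only [map_sub, aeval_C, aeval_X, eq_ratCast, Rat.cast_natCast]
    linarith
  have hT : ∀ x ∈ cube 1, aeval x (C (-(N:ℚ)) - X 0 : MvPolynomial (Fin 1) ℚ) ≠ 0 := by
    intro x hx
    have h0 := (hx 0).1
    simp only [map_sub, aeval_C, aeval_X, eq_ratCast, Rat.cast_neg, Rat.cast_natCast]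
    linarith
  refine ⟨⟨C β, _, hR⟩, ⟨C (2 * β) * X 0, _, hW⟩, ⟨C β, _, hS⟩, ⟨C β, _, hT⟩,
    fun x _ => ?_, fun x _ => ?_, fun x _ => ?_, fun x _ => ?_⟩ <;>
  simp [RFun.fn_apply]

/-- **Stub `stub_dupJoinWeightOne`** (sub-goal D1 of crux `ReductionRigidity`, stmt-3407, line `Sketch`,
cycle 3: the duplication join island): **the weight-one duplication as a chain of two moves.** For
every integer `N ≥ 2`, every rational `β` and any representations `r, s, t` on `[0,1]` with the
printed integrands on it,
`[□¹, β/(N² − p)] − [□¹, β/(N − p)] − [□¹, β/((−N) − p)] ∈ KZ.relations`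
(values `β log(N²/(N² − 1))`, `β log(N/(N − 1))`, `β log(N/(N + 1))`). Moves: the squaring change of
variables `p = u²` (`rel_coordPow_two` in dimension one: `[□¹, β/(N² − p)] ≡ [□¹, 2βu/(N² − u²)]`,
`|dp/du| = 2u`) and one integrand additivity for the partial fraction
`2βu/(N² − u²) = β/(N − u) + β/((−N) − u)`; the quantified representations are bridged to the cube
representations by congruence. [cite: KontsevichZagier2001, §1.2 rules (1), (2)] -/
theorem stub_dupJoinWeightOne : ∀ (N : ℕ), 2 ≤ N → ∀ (β : ℚ) (r s t : IntegralRep 1),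
    r.domain = cube 1 → EqOn r.integrand (fun p => (β : ℝ) / ((N : ℝ) ^ 2 - p 0)) (cube 1) →
    s.domain = cube 1 → EqOn s.integrand (fun p => (β : ℝ) / ((N : ℝ) - p 0)) (cube 1) →
    t.domain = cube 1 → EqOn t.integrand (fun p => (β : ℝ) / ((-(N : ℝ)) - p 0)) (cube 1) →
    KZ.of r - KZ.of s - KZ.of t ∈ KZ.relations := by
  intro N hN β r s t hr hri hs hsi ht hti
  have h2 : (2:ℝ) ≤ (N:ℝ) := by exact_mod_cast hN
  obtain ⟨R, W, S, T, hR, hW, hS, hT⟩ := exists_rfun_dupJoinWeightOne hN β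
  -- congruences with the cube representations
  have er : KZ.of r - KZ.of R.rep ∈ KZ.relations :=
    KZ.of_sub_of_mem_relations_of_eqOn (by rw [RFun.rep_domain, hr]) fun x hx => by
      rw [hr] at hx
      rw [RFun.rep_integrand, hri hx, hR x hx]
  have es : KZ.of s - KZ.of S.rep ∈ KZ.relations :=
    KZ.of_sub_of_mem_relations_of_eqOn (by rw [RFun.rep_domain, hs]) fun x hx => by
      rw [hs] at hx
      rw [RFun.rep_integrand, hsi hx, hS x hx]
  have et : KZ.of t - KZ.of T.rep ∈ KZ.relations :=
    KZ.of_sub_of_mem_relations_of_eqOn (by rw [RFun.rep_domain, ht]) fun x hx => by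
      rw [ht] at hx
      rw [RFun.rep_integrand, hti hx, hT x hx]
  -- the squaring move `[W] ≡ [R]` (`p = u²`, `|dp/du| = 2u`)
  have eWR : KZ.of W.rep - KZ.of R.rep ∈ KZ.relations := by
    refine rel_coordPow_two R W fun x hx => ?_
    have hx2 : BoxIntegral.coordPow 2 x ∈ cube 1 := by
      rw [← image_coordPow_two_cube 1]; exact mem_image_of_mem _ hx
    rw [hW x hx, hR _ hx2, Fin.prod_univ_one, BoxIntegral.coordPow_apply]
    ring
  -- the partial fraction `[W] ≡ [S + T]`
  have eWST : KZ.of W.rep - KZ.of (S.add T).rep ∈ KZ.relations := by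
    refine RFun.rel_of_eqOn fun x hx => ?_
    have h0 := (hx 0).1
    have h1 := (hx 0).2
    have hm : (N:ℝ) - x 0 ≠ 0 := by linarith
    have hp : (-(N:ℝ)) - x 0 ≠ 0 := by linarith
    rw [RFun.fn_add hx, hW x hx, hS x hx, hT x hx]
    have hsq : (N:ℝ) ^ 2 - x 0 ^ 2 = -(((N:ℝ) - x 0) * ((-(N:ℝ)) - x 0)) := by ring
    rw [hsq]
    field_simp
    ring
  have eST := RFun.rel_add S T
  have e : KZ.of r - KZ.of s - KZ.of t =
      (KZ.of r - KZ.of R.rep) - (KZ.of W.rep - KZ.of R.rep) + (KZ.of W.rep - KZ.of (S.add T).rep)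
        + (KZ.of (S.add T).rep - KZ.of S.rep - KZ.of T.rep)
        - (KZ.of s - KZ.of S.rep) - (KZ.of t - KZ.of T.rep) := by abel
  rw [e]
  exact KZ.relations.sub_mem (KZ.relations.sub_mem (KZ.relations.add_mem
    (KZ.relations.add_mem (KZ.relations.sub_mem er eWR) eWST) eST) es) et

end Summit.KontsevichZagierPeriods.HermiteRigidity.ReductionRigidity

end
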